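import Mathlib.MeasureTheory.Function.Jacobian
import Mathlib.Analysis.SpecialFunctions.Pow.Real
import Mathlib.Analysis.Calculus.Deriv.Pow
import Mathlib.LinearAlgebra.Determinant
import Mathlib.MeasureTheory.Constructions.Pi
import HarnessLib

/-!
# The coordinatewise power map `x ↦ (xᵢᵐ)ᵢ` on the open unit box: derivative, Jacobian
`mⁿ ∏ xᵢ^{m−1}`, bijectivity of the box, and the change of variables (the "dilation move")

Companion of the box-integral files (`BoxIntegralZetaValues.lean`, `BoxIntegralHurwitz*.lean`):
the substitution `yᵢ = xᵢᵐ` on the open unit box `{x : Fin n → ℝ | ∀ i, x i ∈ Ioo 0 1}` which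
turns `∫ g(y) dy` into `∫ g((xᵢᵐ)ᵢ) mⁿ ∏ xᵢ^{m−1} dx` and thereby realises the Hurwitz distribution
relations (`Σ_{j<m} ζ(w, (a+j)/m) = mʷ ζ(w, a)`, e.g. the level-`6` and level-`2` relations of
`BoxIntegralHurwitzWeightTwo.lean` / `BoxIntegralHurwitz.lean`) as ONE change of variables. Route
HurwitzMicroSectors of summit KontsevichZagierPeriods calls this its engine (item DilationMove:
"`Φ x = (x_i^m)_i`: polynomial hence `ℚ`-semialgebraic, injective with image the box, derivative
`diag(m x_i^(m−1))` with determinant `m^n ∏ x_i^(m−1) > 0`"; flagged risks: "`Φ''(0,1)ⁿ = (0,1)ⁿ`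
exactly, the Fréchet derivative within the box must be the diagonal CLM whose `.det` is
`m^n ∏ x_i^(m−1)` (truncated `m - 1`, `m = 1` ⇒ identity), and `|det| = det` needs positivity").

This file provides exactly those generic-analysis ingredients (everything but the
`ℚ`-semialgebraicity and the `KZ.changeOfVariablesRel` packaging, which belong to the KZ calculus):

* `BoxIntegral.coordPow m` (`Φₘ`), `BoxIntegral.coordPowDeriv m x` (the diagonal continuous linear
  map `v ↦ (m xᵢ^{m−1} vᵢ)ᵢ`), `hasFDerivAt_coordPow` / `hasFDerivWithinAt_coordPow`;
* `det_coordPowDeriv` — `(Φₘ'(x)).det = mⁿ ∏ᵢ xᵢ^{m−1}` (via `diag`), `det_coordPowDeriv_pos` and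
  `abs_det_coordPowDeriv` on the open box (`m ≥ 1`);
* `injOn_coordPow`, `injOn_coordPow_box`, `mapsTo_coordPow_box`, `image_coordPow_box` —
  `Φₘ '' (0,1)ⁿ = (0,1)ⁿ` exactly (`m ≥ 1`; `m`-th roots);
* `setIntegral_box_eq_setIntegral_coordPow`, `setIntegral_box_eq_setIntegral_comp_pow` — **the
  change of variables** `∫_{(0,1)ⁿ} g = ∫_{(0,1)ⁿ} g((xᵢᵐ)ᵢ) · mⁿ ∏ xᵢ^{m−1}`
  (`MeasureTheory.integral_image_eq_integral_abs_det_fderiv_smul`), and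
  `integrableOn_box_iff_integrableOn_coordPow` — integrability transfers along the move.

`coordPow`, `coordPowDeriv` are real definitions; no named facts (D-0026).

## References

* [KontsevichZagier2001] M. Kontsevich, D. Zagier, *Periods* (2001), §1.2, rule (2) (change of
  variables).
-/

noncomputable section

open MeasureTheory Set Filter Real Finset

namespace Literature.NumberTheory.Transcendental

namespace BoxIntegral

variable {n : ℕ}

/-! ### The open unit box is measurable -/

/-- The open unit box `{x : Fin n → ℝ | ∀ i, x i ∈ (0,1)}` is measurable (it is the product set
`Set.pi univ (fun _ => Ioo 0 1)`). This is the same statement as the tree's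
`Beukers.measurableSet_cube` (`BeukersZetaThreeIntegralsLegendreProofs.lean`); it is re-proved
here (three lines) deliberately, so that this generic change-of-variables utility stays on the
Mathlib layer and does not import the `ζ(3)` proof files (review of p59762). [folklore] -/
theorem measurableSet_box (n : ℕ) : MeasurableSet {x : Fin n → ℝ | ∀ i, x i ∈ Ioo (0 : ℝ) 1} := by
  have h : {x : Fin n → ℝ | ∀ i, x i ∈ Ioo (0 : ℝ) 1} = Set.pi Set.univ fun _ => Ioo (0 : ℝ) 1 := by
    ext x
    simp [Set.mem_pi]
  rw [h]
  exact MeasurableSet.univ_pi fun _ => measurableSet_Ioo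

/-! ### The map and its derivative -/

/-- **The coordinatewise power map** `Φₘ(x) = (xᵢᵐ)ᵢ` on `Fin n → ℝ` (a polynomial, hence
`ℚ`-semialgebraic, self-map; for `m ≥ 1` it maps the open unit box bijectively onto itself).
It realises the Hurwitz distribution ("dilation") relations of the box sectors of the
Kontsevich–Zagier calculus as single change-of-variables moves. [folklore] -/
def coordPow (m : ℕ) (x : Fin n → ℝ) : Fin n → ℝ := fun i => x i ^ m

/-- `Φₘ(x)ᵢ = xᵢᵐ`. [folklore] -/
@[simp] theorem coordPow_apply (m : ℕ) (x : Fin n → ℝ) (i : Fin n) : coordPow m x i = x i ^ m := rfl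

/-- **The derivative of `Φₘ` at `x`**: the diagonal continuous linear map with entries
`m xᵢ^{m−1}` (`v ↦ (m xᵢ^{m−1} vᵢ)ᵢ`). [folklore] -/
def coordPowDeriv (m : ℕ) (x : Fin n → ℝ) : (Fin n → ℝ) →L[ℝ] (Fin n → ℝ) :=
  ContinuousLinearMap.pi fun i => ((m : ℝ) * x i ^ (m - 1)) • ContinuousLinearMap.proj i

/-- `Φₘ'(x) v = (m xᵢ^{m−1} vᵢ)ᵢ`. [folklore] -/
@[simp] theorem coordPowDeriv_apply (m : ℕ) (x v : Fin n → ℝ) (i : Fin n) :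
    coordPowDeriv m x v i = (m : ℝ) * x i ^ (m - 1) * v i := by
  simp [coordPowDeriv]

/-- **`Φₘ` is differentiable with derivative `Φₘ'(x)`** (coordinatewise `d/dt tᵐ = m t^{m−1}`).
[folklore] -/
theorem hasFDerivAt_coordPow (m : ℕ) (x : Fin n → ℝ) :
    HasFDerivAt (coordPow (n := n) m) (coordPowDeriv m x) x := by
  unfold coordPow coordPowDeriv
  refine hasFDerivAt_pi.mpr fun i => ?_
  have h := ((hasDerivAt_pow m (x i)).hasFDerivAt).comp x (hasFDerivAt_apply (𝕜 := ℝ) i x)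
  refine h.congr_fderiv ?_
  ext v
  simp [mul_comm]

/-- … hence within any set. [folklore] -/
theorem hasFDerivWithinAt_coordPow (m : ℕ) (s : Set (Fin n → ℝ)) (x : Fin n → ℝ) :
    HasFDerivWithinAt (coordPow (n := n) m) (coordPowDeriv m x) s x :=
  (hasFDerivAt_coordPow m x).hasFDerivWithinAt

/-! ### The Jacobian determinant -/

/-- As a linear map, `Φₘ'(x)` is the matrix `diag(m xᵢ^{m−1})`. [folklore] -/
theorem coe_coordPowDeriv_eq_toLin' (m : ℕ) (x : Fin n → ℝ) :
    (coordPowDeriv m x : (Fin n → ℝ) →ₗ[ℝ] (Fin n → ℝ))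
      = Matrix.toLin' (Matrix.diagonal fun i => (m : ℝ) * x i ^ (m - 1)) := by
  refine LinearMap.ext fun v => funext fun i => ?_
  rw [ContinuousLinearMap.coe_coe, coordPowDeriv_apply, Matrix.toLin'_apply, Matrix.mulVec_diagonal]

/-- **`det Φₘ'(x) = ∏ᵢ m xᵢ^{m−1} = mⁿ ∏ᵢ xᵢ^{m−1}`.** [folklore] -/
theorem det_coordPowDeriv (m : ℕ) (x : Fin n → ℝ) :
    (coordPowDeriv m x).det = (m : ℝ) ^ n * ∏ i, x i ^ (m - 1) := by
  rw [ContinuousLinearMap.det, coe_coordPowDeriv_eq_toLin', LinearMap.det_toLin',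
    Matrix.det_diagonal, Finset.prod_mul_distrib, Finset.prod_const, Finset.card_univ,
    Fintype.card_fin]

/-- On the open unit box the Jacobian is positive (`m ≥ 1`; for `m = 1` it is `1`). [folklore] -/
theorem det_coordPowDeriv_pos {m : ℕ} (hm : m ≠ 0) {x : Fin n → ℝ}
    (hx : ∀ i, x i ∈ Ioo (0 : ℝ) 1) : 0 < (coordPowDeriv m x).det := by
  rw [det_coordPowDeriv]
  have hm' : (0 : ℝ) < m := by exact_mod_cast Nat.pos_of_ne_zero hm
  exact mul_pos (pow_pos hm' n) (Finset.prod_pos fun i _ => pow_pos (hx i).1 _)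

/-- **`|det Φₘ'(x)| = mⁿ ∏ᵢ xᵢ^{m−1}` on the open unit box** — the factor printed in the dilation
move of route HurwitzMicroSectors ("`r.integrand x = r'.integrand (xᵢᵐ)ᵢ · mⁿ ∏ᵢ xᵢ^(m−1)`").
[folklore] -/
theorem abs_det_coordPowDeriv {m : ℕ} (hm : m ≠ 0) {x : Fin n → ℝ} (hx : ∀ i, x i ∈ Ioo (0 : ℝ) 1) :
    |(coordPowDeriv m x).det| = (m : ℝ) ^ n * ∏ i, x i ^ (m - 1) := by
  rw [abs_of_pos (det_coordPowDeriv_pos hm hx), det_coordPowDeriv]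

/-! ### `Φₘ` maps the open unit box bijectively onto itself (`m ≥ 1`) -/

/-- `Φₘ` is injective on the closed nonnegative orthant, hence on the box. [folklore] -/
theorem injOn_coordPow {m : ℕ} (hm : m ≠ 0) :
    InjOn (coordPow (n := n) m) {x | ∀ i, 0 ≤ x i} := by
  intro x hx y hy hxy
  funext i
  have h := congr_fun hxy i
  simp only [coordPow_apply] at h
  exact (pow_left_inj₀ (hx i) (hy i) hm).mp h

/-- `Φₘ` is injective on the open unit box. [folklore] -/
theorem injOn_coordPow_box {m : ℕ} (hm : m ≠ 0) :
    InjOn (coordPow (n := n) m) {x | ∀ i, x i ∈ Ioo (0 : ℝ) 1} :=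
  (injOn_coordPow hm).mono fun _ hx i => (hx i).1.le

/-- `Φₘ` maps the open unit box into itself. [folklore] -/
theorem mapsTo_coordPow_box {m : ℕ} (hm : m ≠ 0) :
    MapsTo (coordPow (n := n) m) {x | ∀ i, x i ∈ Ioo (0 : ℝ) 1} {x | ∀ i, x i ∈ Ioo (0 : ℝ) 1} :=
  fun _ hx i => ⟨pow_pos (hx i).1 m, pow_lt_one₀ (hx i).1.le (hx i).2 hm⟩

/-- **`Φₘ '' (0,1)ⁿ = (0,1)ⁿ` exactly** (`m ≥ 1`): every `y` in the box is `Φₘ(x)` with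
`xᵢ = yᵢ^{1/m} ∈ (0,1)`. [folklore] -/
theorem image_coordPow_box {m : ℕ} (hm : m ≠ 0) :
    coordPow (n := n) m '' {x | ∀ i, x i ∈ Ioo (0 : ℝ) 1} = {x | ∀ i, x i ∈ Ioo (0 : ℝ) 1} := by
  refine (mapsTo_coordPow_box hm).image_subset.antisymm fun y hy => ?_
  refine ⟨fun i => y i ^ ((m : ℝ)⁻¹), fun i => ⟨?_, ?_⟩, ?_⟩
  · exact Real.rpow_pos_of_pos (hy i).1 _
  · exact Real.rpow_lt_one (hy i).1.le (hy i).2 (by positivity)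
  · funext i
    simp only [coordPow_apply]
    exact Real.rpow_inv_natCast_pow (hy i).1.le hm

/-! ### The change of variables on the box (the "dilation move") -/

/-- **Change of variables by `Φₘ` on the open unit box** (`m ≥ 1`): for every `g`,
`∫_{(0,1)ⁿ} g(y) dy = ∫_{(0,1)ⁿ} mⁿ ∏ᵢ xᵢ^{m−1} · g((xᵢᵐ)ᵢ) dx`
(`MeasureTheory.integral_image_eq_integral_abs_det_fderiv_smul` with `Φₘ '' box = box`,
`|det Φₘ'| = mⁿ ∏ xᵢ^{m−1}` on the box). This is the analytic content of the single
change-of-variables move realising the Hurwitz distribution relations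
`Σ_{j<m} ζ(w, (a+j)/m)`-type identities inside rule (2) of the Kontsevich–Zagier calculus
(route HurwitzMicroSectors, item DilationMove). [folklore] -/
theorem setIntegral_box_eq_setIntegral_coordPow {m : ℕ} (hm : m ≠ 0) (g : (Fin n → ℝ) → ℝ) :
    ∫ y in {x : Fin n → ℝ | ∀ i, x i ∈ Ioo (0 : ℝ) 1}, g y
      = ∫ x in {x : Fin n → ℝ | ∀ i, x i ∈ Ioo (0 : ℝ) 1},
          ((m : ℝ) ^ n * ∏ i, x i ^ (m - 1)) * g (coordPow m x) := by
  have h := integral_image_eq_integral_abs_det_fderiv_smul volume (measurableSet_box n)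
    (fun x _ => hasFDerivWithinAt_coordPow m _ x) (injOn_coordPow_box hm) g
  rw [image_coordPow_box hm] at h
  rw [h]
  refine setIntegral_congr_fun (measurableSet_box n) fun x hx => ?_
  rw [smul_eq_mul, abs_det_coordPowDeriv hm hx]

/-- The same with the product map written in coordinates `fun i => x i ^ m` (the literal shape of
route item DilationMove). [folklore] -/
theorem setIntegral_box_eq_setIntegral_comp_pow {m : ℕ} (hm : m ≠ 0) (g : (Fin n → ℝ) → ℝ) :
    ∫ y in {x : Fin n → ℝ | ∀ i, x i ∈ Ioo (0 : ℝ) 1}, g y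
      = ∫ x in {x : Fin n → ℝ | ∀ i, x i ∈ Ioo (0 : ℝ) 1},
          g (fun i => x i ^ m) * ((m : ℝ) ^ n * ∏ i, x i ^ (m - 1)) := by
  rw [setIntegral_box_eq_setIntegral_coordPow hm g]
  refine setIntegral_congr_fun (measurableSet_box n) fun x _ => ?_
  rw [mul_comm]
  rfl

/-- **Integrability transfers along the move**: `g` is integrable on the box iff
`x ↦ mⁿ ∏ xᵢ^{m−1} g(Φₘ x)` is (`MeasureTheory.integrableOn_image_iff_integrableOn_abs_det_fderiv_smul`).
[folklore] -/
theorem integrableOn_box_iff_integrableOn_coordPow {m : ℕ} (hm : m ≠ 0) (g : (Fin n → ℝ) → ℝ) :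
    IntegrableOn g {x : Fin n → ℝ | ∀ i, x i ∈ Ioo (0 : ℝ) 1} volume ↔
      IntegrableOn (fun x : Fin n → ℝ => ((m : ℝ) ^ n * ∏ i, x i ^ (m - 1)) * g (coordPow m x))
        {x | ∀ i, x i ∈ Ioo (0 : ℝ) 1} volume := by
  have h := integrableOn_image_iff_integrableOn_abs_det_fderiv_smul volume
    (measurableSet_box n) (fun x _ => hasFDerivWithinAt_coordPow m _ x)
    (injOn_coordPow_box hm) g
  rw [image_coordPow_box hm] at h
  rw [h]
  refine integrableOn_congr_fun (fun x hx => ?_) (measurableSet_box n)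
  rw [smul_eq_mul, abs_det_coordPowDeriv hm hx]

end BoxIntegral

end Literature.NumberTheory.Transcendental
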